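import Mathlib.Algebra.BigOperators.Finprod
import Literature.Analysis.FluidPDE.HardSphereCollisionRecord
import Literature.MathematicalPhysics.KineticTheory.HardSphereEuler
import Literature.MathematicalPhysics.KineticTheory.HardSphereCampbellWindows
import HarnessLib

/-!
# Window bookkeeping of collision pair sums along a good orbit

Helper file of the lead prover for the registered stub `stub_slabShiftDecomp` (S2) of the line
`KineticSlabSketch` of the crux `JParityClosure.OddContactSymmetry` (stmt-AtomisticToContinuum-17722).
The line decomposes a full-window collision statistic over `(0, W ℓ]` into `W` consecutive kinetic
SLABS `(w ℓ, (w + 1) ℓ]` and rewrites each slab sum as the slab-`(0, ℓ]` sum of the time-shifted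
summand along the orbit of the slab start `Φ_{wℓ} z`.  This file is the PATHWISE bookkeeping on a good
initial datum `z ∈ Φ.good` of a hard-sphere flow `Φ` (Gallagher–Saint-Raymond–Texier 2013,
Prop. 4.1.1 / Def. 4.1.2: on the good set the flow is a one-parameter group of hard-sphere
trajectories with locally finitely many collisions), for collision pair sums
`Φ.collisionPairSum S g z = Σ_{t ∈ collisionTimes ∩ S} Σ_{(i,j) in contact at t} g t (Φ_t z) i j` whose
summand sees the time AND the current configuration:

* `collisionPairSum_Ioc_flow_shift` — THE SHIFT: by `Φ_t (Φ_s z) = Φ_{t+s} z`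
  (`HardSphereFlow.flow_add`) the sum over `(s + a, s + b]` along the orbit of `z` is the sum over
  `(a, b]` of the shifted summand `t ↦ g (t + s)` along the orbit of `Φ_s z`
  (`finsum_mem_eq_of_bijOn` under `t ↦ t + s`; the time-independent case is
  `campbell_collisionPairSum_flow_shift_Ioc` of `HardSphereCampbellWindows`);
* `collisionPairSum_Ioc_eq_sum_range` — ADDITIVITY over consecutive slabs,
  `CPS((0, W ℓ]) = Σ_{w < W} CPS((w ℓ, (w + 1) ℓ])` for `0 ≤ ℓ` (induction on `W`,
  `campbell_collisionPairSum_Ioc_split`, i.e. `collisionPairSum_union` with the finiteness of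
  collision times on bounded windows of a good orbit);
* `collisionPairSum_Icc_eq_Ioc_of_not_mem` — CLOSED VERSUS HALF-OPEN WINDOW: if `a` is not a
  collision time of the curve then the sums over `[a, b]` and `(a, b]` agree (same set of collision
  times; no finiteness needed);
* `stub_slabShiftDecomp` — the registered conjunction of the three, on `𝕋³`.

## References

* I. Gallagher, L. Saint-Raymond, B. Texier, *From Newton to Boltzmann: hard spheres and
  short-range potentials*, EMS (2013), §4.1, Prop. 4.1.1, Def. 4.1.2.
* C. Cercignani, R. Illner, M. Pulvirenti, *The Mathematical Theory of Dilute Gases*, Springer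
  (1994), §4.2 (the hard-sphere flow as a one-parameter group; stationarity bookkeeping).
-/

noncomputable section

open Set MeasureTheory Filter
open Literature.Analysis.FluidPDE Literature.MathematicalPhysics.KineticTheory

namespace Summit.AtomisticToContinuum.HydrodynamicLimit.Theorems.OddContactSymmetryKineticSlab

section General

variable {d : Type*} [Fintype d] {X : Type*} {N : ℕ} {G : Geometry d X} {ε : ℝ}

/-! ## Curve level: closed versus half-open window -/

/-- **Closed versus half-open window.** If the left end point `a` is not a collision time of the
curve `γ`, the collision pair sums over `[a, b]` and over `(a, b]` coincide (the two windows contain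
the same collision times). [folklore] -/
theorem collisionPairSum_Icc_eq_Ioc_of_not_mem {M : Type*} [AddCommMonoid M]
    {γ : ℝ → Config N d X} {a : ℝ} (ha : a ∉ collisionTimes G ε γ) (b : ℝ)
    (g : ℝ → Fin N → Fin N → M) :
    collisionPairSum G ε γ (Icc a b) g = collisionPairSum G ε γ (Ioc a b) g := by
  unfold Literature.Analysis.FluidPDE.collisionPairSum
  refine finsum_mem_congr ?_ fun _ _ => rfl
  ext t
  simp only [mem_inter_iff, mem_Icc, mem_Ioc]
  constructor
  · rintro ⟨ht, hat, htb⟩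
    refine ⟨ht, lt_of_le_of_ne hat ?_, htb⟩
    rintro rfl
    exact ha ht
  · rintro ⟨ht, hat, htb⟩
    exact ⟨ht, hat.le, htb⟩

/-! ## Flow level: the shift and the slab decomposition -/

variable [MeasureSpace X] [TopologicalSpace X]

/-- **The shift of a collision pair sum along the flow** (time- and configuration-dependent
summand): for a good initial datum `z`, the collision pair sum over `(s + a, s + b]` along the
orbit of `z` is the collision pair sum over `(a, b]` of the time-shifted summand `t ↦ g (t + s)`
along the orbit of `Φ_s z` — by the group property `Φ_t (Φ_s z) = Φ_{t+s} z` the collision times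
of the orbit of `Φ_s z` are the collision times of the orbit of `z` translated by `-s`
(GST 2013 Prop. 4.1.1). [folklore] -/
theorem collisionPairSum_Ioc_flow_shift {M : Type*} [AddCommMonoid M] (Φ : HardSphereFlow G ε N)
    (g : ℝ → Config N d X → Fin N → Fin N → M) {z : Config N d X} (hz : z ∈ Φ.good)
    (s a b : ℝ) :
    Φ.collisionPairSum (Ioc (s + a) (s + b)) g z =
      Φ.collisionPairSum (Ioc a b) (fun t => g (t + s)) (Φ.flow s z) := by
  unfold HardSphereFlow.collisionPairSum Literature.Analysis.FluidPDE.collisionPairSum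
  rw [campbell_collisionTimes_flow_shift Φ hz s]
  symm
  -- adapted from `campbell_collisionPairSum_flow_shift` (HardSphereCampbellWindows)
  refine finsum_mem_eq_of_bijOn (fun u => u + s) ⟨?_, (add_left_injective s).injOn, ?_⟩ ?_
  · rintro u ⟨hu, hua, hub⟩
    exact ⟨hu, by linarith, by linarith⟩
  · rintro u ⟨hu, hua, hub⟩
    exact ⟨u - s, ⟨by simpa only [mem_preimage, sub_add_cancel] using hu, by linarith, by linarith⟩,
      sub_add_cancel u s⟩
  · intro u _
    simp only [← Φ.flow_add u s z hz]

/-- **Slab decomposition of a collision pair sum along a good orbit**: for a good initial datum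
`z` and a slab length `0 ≤ ℓ`, the collision pair sum over `(0, W ℓ]` is the sum over the slab
indices `w < W` of the collision pair sums over the consecutive slabs `(w ℓ, (w + 1) ℓ]`
(additivity over disjoint windows, finitely many collision times in each bounded window of a good
orbit; GST 2013 Prop. 4.1.1). [folklore] -/
theorem collisionPairSum_Ioc_eq_sum_range {M : Type*} [AddCommMonoid M] (Φ : HardSphereFlow G ε N)
    (g : ℝ → Config N d X → Fin N → Fin N → M) {z : Config N d X} (hz : z ∈ Φ.good) {ℓ : ℝ}
    (hℓ : 0 ≤ ℓ) (W : ℕ) :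
    Φ.collisionPairSum (Ioc 0 ((W : ℝ) * ℓ)) g z =
      ∑ w ∈ Finset.range W, Φ.collisionPairSum (Ioc ((w : ℝ) * ℓ) (((w : ℝ) + 1) * ℓ)) g z := by
  induction W with
  | zero => simp [HardSphereFlow.collisionPairSum]
  | succ W ih =>
    rw [Finset.sum_range_succ, ← ih, Nat.cast_succ]
    exact campbell_collisionPairSum_Ioc_split Φ hz (by positivity) (by nlinarith) g

end General

/-! ## The registered stub -/

/-- **S2 `stub_slabShiftDecomp` — window bookkeeping of collision pair sums along a good orbit.**  For a
hard-sphere flow `Φ` on `𝕋³`, a summand `gm t z i j` seeing the time, the current configuration and the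
ordered pair, and a good initial datum `z`: (a) SHIFT — the sum over `(s + a, s + b]` along the orbit
of `z` is the sum over `(a, b]` of the shifted summand `gm (· + s)` along the orbit of `Φ_s z`;
(b) ADDITIVITY — the sum over `(0, W ℓ]` is the sum of the sums over the consecutive slabs
`(w ℓ, (w + 1) ℓ]`, `w < W` (`0 ≤ ℓ`); (c) if `0` is not a collision time of the orbit, the sums over
`[0, b]` and `(0, b]` agree. [folklore] -/
theorem stub_slabShiftDecomp {ε : ℝ} {n : ℕ} (Φ : HardSphereFlow (Torus.geometry (Fin 3)) ε n)
    (gm : ℝ → Config n (Fin 3) T3 → Fin n → Fin n → ℝ) {z : Config n (Fin 3) T3} (hz : z ∈ Φ.good) :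
    (∀ s a b : ℝ, Φ.collisionPairSum (Set.Ioc (s + a) (s + b)) gm z =
        Φ.collisionPairSum (Set.Ioc a b) (fun t => gm (t + s)) (Φ.flow s z)) ∧
    (∀ ℓ : ℝ, 0 ≤ ℓ → ∀ W : ℕ, Φ.collisionPairSum (Set.Ioc 0 ((W : ℝ) * ℓ)) gm z =
        ∑ w ∈ Finset.range W, Φ.collisionPairSum (Set.Ioc ((w : ℝ) * ℓ) (((w : ℝ) + 1) * ℓ)) gm z) ∧
    ((0 : ℝ) ∉ collisionTimes (Torus.geometry (Fin 3)) ε (fun t => Φ.flow t z) →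
      ∀ b : ℝ, Φ.collisionPairSum (Set.Icc 0 b) gm z = Φ.collisionPairSum (Set.Ioc 0 b) gm z) :=
  ⟨fun s a b => collisionPairSum_Ioc_flow_shift Φ gm hz s a b,
    fun _ hℓ W => collisionPairSum_Ioc_eq_sum_range Φ gm hz hℓ W,
    fun h0 b => collisionPairSum_Icc_eq_Ioc_of_not_mem h0 b _⟩

end Summit.AtomisticToContinuum.HydrodynamicLimit.Theorems.OddContactSymmetryKineticSlab

end
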